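import Summits.Ventures.PercRepro0.Glue

/-!
# Block L glue, kernel-checked: continuity of `p ↦ P_p(A_n)` (L2/G2)

Cell pub-perc-repro0, seat p2.  An event that depends only on finitely many bonds is a finite
disjoint union of cylinder events, each of which has `P_p`-probability a monomial in `p`, `1 - p`;
hence its probability is a polynomial in `p`, in particular continuous (`continuous_measureReal_local`).
`A_n = Reach d n` depends only on the bonds inside `Λ_n` (`reach_local`), so `p ↦ P_p(A_n)` is
continuous (`continuous_reach`).
-/

open MeasureTheory ProbabilityTheory

namespace Summit.Ventures.PercRepro0

variable {d : ℕ}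

-- BEGIN BODY

/-! ### Locality of `A_n` -/

/-- The set of bonds with both endpoints in the box `Λ_n`. -/
def boxBonds (d n : ℕ) : Set (Bond d) := {b | nrm b.src ≤ n ∧ nrm b.tgt ≤ n}

/-- There are finitely many bonds inside `Λ_n`. -/
lemma finite_boxBonds (n : ℕ) : (boxBonds d n).Finite := by
  refine ((finite_box (d := d) n).prod (Set.finite_univ (α := Fin d))).subset ?_
  intro b hb
  exact ⟨hb.1, Set.mem_univ _⟩

/-- Connections inside `Λ_n` depend only on the states of the bonds inside `Λ_n`. -/
lemma connIn_local {n : ℕ} {ω ω' : Config d} (h : ∀ b ∈ boxBonds d n, ω b = ω' b)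
    {x y : Vertex d} (hc : ConnIn n ω x y) : ConnIn n ω' x y := by
  induction hc with
  | refl => exact Relation.ReflTransGen.refl
  | tail _ hadj ih =>
    refine ih.tail ?_
    obtain ⟨⟨b, hb, hxz⟩, hx, hz⟩ := hadj
    refine ⟨⟨b, ?_, hxz⟩, hx, hz⟩
    rw [← h b ?_]
    · exact hb
    · rcases hxz with ⟨h1, h2⟩ | ⟨h1, h2⟩
      · exact ⟨by rw [h1]; exact hx, by rw [h2]; exact hz⟩
      · exact ⟨by rw [h1]; exact hz, by rw [h2]; exact hx⟩

/-- `A_n` depends only on the states of the bonds inside `Λ_n`. -/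
lemma reach_local {n : ℕ} {ω ω' : Config d} (h : ∀ b ∈ boxBonds d n, ω b = ω' b)
    (hω : ω ∈ Reach d n) : ω' ∈ Reach d n := by
  obtain ⟨y, hy, hc⟩ := hω
  exact ⟨y, hy, connIn_local h hc⟩

/-! ### Finite-dimensional events are finite disjoint unions of cylinders -/

/-- Extend a configuration given on the bonds of `E` by `false` outside `E`. -/
def extendCfg (E : Finset (Bond d)) (η : E → Bool) : Config d :=
  fun b => if h : b ∈ E then η ⟨b, h⟩ else false

/-- The cylinder event "`ω` agrees with `η` on `E`". -/
def cylE (E : Finset (Bond d)) (η : E → Bool) : Set (Config d) :=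
  Set.pi (↑E) fun b => {extendCfg E η b}

/-- Membership in a cylinder event. -/
lemma mem_cylE {E : Finset (Bond d)} {η : E → Bool} {ω : Config d} :
    ω ∈ cylE E η ↔ ∀ b : E, ω b = η b := by
  simp only [cylE, Set.mem_pi, Finset.mem_coe, Set.mem_singleton_iff, extendCfg]
  constructor
  · intro h b
    have := h b b.2
    simpa [b.2] using this
  · intro h b hb
    have := h ⟨b, hb⟩
    simp [hb, this]

/-- Cylinder events are measurable. -/
lemma measurableSet_cylE (E : Finset (Bond d)) (η : E → Bool) : MeasurableSet (cylE E η) :=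
  MeasurableSet.pi E.countable_toSet fun _ _ => measurableSet_singleton _

/-- Distinct cylinders are disjoint. -/
lemma cylE_pairwiseDisjoint (E : Finset (Bond d)) :
    Set.PairwiseDisjoint (Set.univ : Set (E → Bool)) (cylE E) := by
  intro η _ η' _ hne
  rw [Function.onFun, Set.disjoint_left]
  intro ω h1 h2
  apply hne
  funext b
  rw [← mem_cylE.1 h1 b, ← mem_cylE.1 h2 b]

/-- The `P_p`-probability of a cylinder event is a monomial in `p` and `1 - p`. -/
lemma measureReal_cylE (E : Finset (Bond d)) (η : E → Bool) (p : unitInterval) :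
    (percMeasure d p).real (cylE E η) =
      ∏ b ∈ E, (if extendCfg E η b then (p : ℝ) else 1 - p) := by
  rw [measureReal_def, percMeasure, cylE,
    Measure.infinitePi_pi _ fun b _ => measurableSet_singleton _, ENNReal.toReal_prod]
  refine Finset.prod_congr rfl fun b _ => ?_
  rw [← measureReal_def]
  cases extendCfg E η b
  · simp
  · simp

/-- The finite set of restrictions `η : E → Bool` whose extension by `false` lies in `A`. -/
noncomputable def locSet (E : Finset (Bond d)) (A : Set (Config d)) : Finset (E → Bool) := by
  classical exact Finset.univ.filter fun η => extendCfg E η ∈ A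

/-- Membership in `locSet`. -/
lemma mem_locSet {E : Finset (Bond d)} {A : Set (Config d)} {η : E → Bool} :
    η ∈ locSet E A ↔ extendCfg E η ∈ A := by
  classical
  simp [locSet]

/-- An event determined by the bonds of a finite set `E` is the disjoint union of the cylinders
`cylE E η` over those `η` whose extension lies in the event. -/
lemma local_eq_biUnion {E : Finset (Bond d)} {A : Set (Config d)}
    (hA : ∀ ω ω' : Config d, (∀ b ∈ E, ω b = ω' b) → ω ∈ A → ω' ∈ A) :
    A = ⋃ η ∈ locSet E A, cylE E η := by
  ext ω
  simp only [Set.mem_iUnion, exists_prop, mem_locSet]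
  constructor
  · intro hω
    refine ⟨fun b => ω b, ?_, ?_⟩
    · refine hA ω _ ?_ hω
      intro b hb
      simp [extendCfg, hb]
    · exact mem_cylE.2 fun b => rfl
  · rintro ⟨η, hη, hω⟩
    refine hA (extendCfg E η) ω ?_ hη
    intro b hb
    have := mem_cylE.1 hω ⟨b, hb⟩
    simp [extendCfg, hb, this]

/-- G2 (general form): the `P_p`-probability of an event determined by finitely many bonds is a
polynomial in `p`, written as a finite sum of monomials. -/
lemma measureReal_local (E : Finset (Bond d)) {A : Set (Config d)}
    (hA : ∀ ω ω' : Config d, (∀ b ∈ E, ω b = ω' b) → ω ∈ A → ω' ∈ A) (p : unitInterval) :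
    (percMeasure d p).real A =
      ∑ η ∈ locSet E A, ∏ b ∈ E, (if extendCfg E η b then (p : ℝ) else 1 - p) := by
  calc (percMeasure d p).real A
      = (percMeasure d p).real (⋃ η ∈ locSet E A, cylE E η) := by rw [← local_eq_biUnion hA]
    _ = ∑ η ∈ locSet E A, (percMeasure d p).real (cylE E η) :=
        measureReal_biUnion_finset ((cylE_pairwiseDisjoint E).subset (Set.subset_univ _))
          (fun η _ => measurableSet_cylE E η)
    _ = ∑ η ∈ locSet E A, ∏ b ∈ E, (if extendCfg E η b then (p : ℝ) else 1 - p) :=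
        Finset.sum_congr rfl fun η _ => measureReal_cylE E η p

/-- G2: the `P_p`-probability of an event determined by finitely many bonds is continuous in `p`. -/
lemma continuous_measureReal_local (E : Finset (Bond d)) {A : Set (Config d)}
    (hA : ∀ ω ω' : Config d, (∀ b ∈ E, ω b = ω' b) → ω ∈ A → ω' ∈ A) :
    Continuous fun p : unitInterval => (percMeasure d p).real A := by
  have : (fun p : unitInterval => (percMeasure d p).real A) = fun p : unitInterval =>
      ∑ η ∈ locSet E A, ∏ b ∈ E, (if extendCfg E η b then (p : ℝ) else 1 - p) :=
    funext fun p => measureReal_local E hA p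
  rw [this]
  refine continuous_finsetSum _ fun η _ => continuous_finsetProd _ fun b _ => ?_
  split_ifs
  · exact continuous_subtype_val
  · exact continuous_const.sub continuous_subtype_val

/-- G2 for `A_n`: `p ↦ P_p(A_n)` is continuous on `[0,1]`. -/
lemma continuous_reach (n : ℕ) :
    Continuous fun p : unitInterval => (percMeasure d p).real (Reach d n) := by
  refine continuous_measureReal_local (finite_boxBonds (d := d) n).toFinset fun ω ω' h => ?_
  refine reach_local fun b hb => h b ?_
  exact (finite_boxBonds n).mem_toFinset.2 hb

-- END BODY

end Summit.Ventures.PercRepro0
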